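import Summits.BirchSwinnertonDyer.BirchSwinnertonDyer.Theorems.ByReductionTypeAtTwoOrdKatoHalfAtTwoIsoRelaxedGenuineDefs
import Summits.BirchSwinnertonDyer.BirchSwinnertonDyer.Theorems.ByReductionTypeAtTwoOrdKatoHalfAtTwoIsoColemanHalfClassOff514
import Literature.NumberTheory.EllipticCurves.IwasawaModuleFinitePadicIntProofs
import HarnessLib

/-!
# Route ByReductionTypeAtTwo, crux `OrdKatoHalfAtTwoIso` (stmt-BirchSwinnertonDyer-19573), cell [`ρ̄₂` onto ∧ `0 < Δ`]
# (PAIR child 24097, conjunct `OrdKatoHalfAtTwoIsoPosDisc`): the open residual of the RELAXED-GENUINE road typed as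
# «Iw⁺ GIVEN Q⁺» — the real-signature statement R∞⁺ — so that the road's research input is Q⁺ ∧ R∞⁺ and Q⁺ is not paid twice;
# the conjunct, the PAIR child and the crux BY NAME — the P⁺-FREE proof of the conjunct on the R∞-locus, the DISPLAYED ALTERNATIVE
# DOOR of skeleton v17 of line `steinberg-fibre-at-two` (pen RC-422 (1); one definition + theorems)

Seat `cruxlead-stmt-BirchSwinnertonDyer-19573` g7 (LEAD PROVER, MODE LINE; HOME `run/shared/lean/pub/bsd-2adic/`; pen RC-417 (2) /
RC-419 (1) STANDING WORD: «when the relaxed PosDisc door lands BY NAME, integrate it as {R⁺ (memo) + Aʳ (reserve)} replacing P⁺ ONLY,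
and type the open residual as «Iw⁺ given Q⁺» (= R∞ by triage THEOREM I: Iw⁺ ⟺ Q⁺ ∧ R∞), NOT as a bare Iw⁺ stub that swallows Q⁺»;
w2 GEN 5 landed the door p705378 `ordKatoHalfAtTwoIsoPosDisc_of_relaxedZeta_of_arch_of_relaxedConjA`). HONEST FRAMING (cell
bsd-2adic): BSD is not proved by any of this; the crux, its PAIR child 24097, its `0 < Δ` conjunct and B7′ are NOT proved here. ONE
DEFINITION of an OPEN statement displayed BY NAME (nothing asserted about it; NOT a Literature fact) + THEOREMS, each CONDITIONAL on the
displayed OPEN statements it names and on PRINT facts by name. No `sorry`.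

WHAT. The relaxed `μ`-door (w2 p703778/p704497/p705378) consumes relaxed (A₂) on the cell — «`Sel₀^{rel ∞}(W/ℚ_∞)[2]` finite», i.e.
`ℓ₍₂₎(X₀^{rel ∞}) = 0` — which is STRONGER than the cell's named research target Q⁺ (Coates–Sujatha (A) at `2`, STRICT at `∞`,
`FineSelmerConjATwoOrdPosDisc`; NECESSARY for the crux, p702303/p703881) by exactly one real-signature bit R∞ (crux-triage r1-1 F-29b /
F-31 (a), r1-2 GEN 37 THEOREM I: relaxed (A₂) ⟺ Q⁺ ∧ R∞; R∞ ⟺ `ker(X₀^{rel ∞} ↠ X₀)` finite ⟺ `loc_∞ ≢ 0` on `𝐇¹(T₂W) ≅ Λ`; R∞ is NOT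
known necessary for the crux, Prop J). This file types the residual in the tree's carriers, AS AN IMPLICATION so that it does not
contain Q⁺:

* §1 `RealSignatureFineTwoOrdPosDisc` (R∞⁺): on the cell, for every cyclotomic `κ`, «`Sel₀(W/ℚ_∞)[2]` finite ⟹ `Sel₀^{rel ∞}(W/ℚ_∞)[2]`
  finite» (`fineSelmerInfty` / `fineSelmerInftyRelaxedInf` `2`-torsion); `Iff.rfl`; monotone suppliers: relaxed finiteness on the cell
  ⟹ R∞⁺ (`…_of_relaxedFinite`); **Iw⁺ + Lim 2017 Thm 3.5 at `2` UPSTAIRS ⟹ R∞⁺** (`…_of_lim_upstairs_of_classicalMu`, over bsd-f1-sign2's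
  kernel descent `LimDescent.finite_pTorsion_fineRelaxed_of_upstairs`) — the (ε) supply Iw⁺ pays for it.
* §2 THEOREM I's easy halves in the kernel: `relaxedConjATwoPosDisc_of_conjA_of_realSignature` — Q⁺ ∧ R∞⁺ ⟹ relaxed (A₂) on the cell in
  the door's currency (`ℓ₍₂₎(Yr.X) = 0` for every relaxed fine dual datum; `IwasawaModuleFinitePadicInt.finite_pTorsion_of_fineSelmerDualData_moduleFinite`
  + `LimRelUpstairs.lengthAt_relaxed_eq_zero_of_finite_pTorsion`); `conjA_and_realSignature_of_relaxedFinite` — relaxed finiteness ⟹ Q⁺ ∧ R∞⁺.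
* §3 DOORS BY NAME: `ordKatoHalfAtTwoIsoPosDisc_of_relaxedZeta_of_arch_of_conjA_of_realSignature` — the `0 < Δ` conjunct ⟸ R⁺ (memo, Kato's
  GENUINE classes) + Aʳ (print-composite reading, reserve; NOT kernel today — pen RC-422 (2)) + Q⁺ + R∞⁺ + PRINT {Abbes–Ullmo, Kato 17.4
  (1)(2)@2}; the PAIR child 24097 (`ordKatoFineZetaAtTwoResidue_of_negDisc_of_relaxedZeta_of_arch_of_conjA_of_realSignature`); **the crux**
  `ordKatoHalfAtTwoIso_of_negDisc_of_relaxedZeta_of_arch_of_conjA_of_realSignature_of_halfClassOff514_of_print` ⟸ F1μι⁻ · R⁺ · Aʳ · Q⁺ ·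
  R∞⁺ · Col½-opt-off514 · PRINT {bundle 23889 = PUB ∧ AU ∧ 5.14@2, Lim@2, FW} (split door `ordKatoHalfAtTwoIso_of_iota_halves`, B7′ from the
  lead g7 off-5.14 door p705499). EXTENT (crux-triage r1-2 GEN 38 COROLLARY K / pen RC-422 (1)): these doors prove the conjunct EXACTLY ON
  THE R∞-LOCUS — extent «conjunct ∧ R∞», short of the conjunct by the real-signature bit, which is why skeleton v17 keeps the (ε) pair
  {P⁺, Q⁺} REGISTERED (extent-exact at memo tier) and DISPLAYS this road as the alternative door (`crux_of_relaxedGenuine_road`); a registered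
  relaxed variant would be a SECOND line `steinberg-fibre-at-two-relaxed` with this §3 as its composition.

References: [CoatesSujatha2005] Conj. A, Thm. 3.4; [Lim2017FineSelmer] §3 Thm. 3.5, Lemma 3.2; [LimSujatha2018] §3; [GreenbergLNM1716] §4
Lemma 4.6 (pp. 105–107), Prop. 5.14; [Kato2004Asterisque] Thm. 17.4 (1)(2), Prop. 17.11, §17.13; [Iwasawa1973MuInvariants] §1; tree p699544
(`…PosDiscEpsilonDefs`), p703778/p704497/p705378 (w2 GEN 5), p705499 (lead g7), `…FineRoadLimDescent` / `…LimRelUpstairs` / `…RelaxedCoefficients`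
(bsd-f1-sign2), `IwasawaModuleFinitePadicIntProofs`; triage `TRIAGE-r1-1.md` F-29b/F-31, `TRIAGE-r1-2.md` GEN 37 (Thm I, Prop J).
-/

set_option autoImplicit false
set_option linter.dupNamespace false

noncomputable section

open scoped Classical MatrixGroups ModularForm NumberField
open CongruenceSubgroup WeierstrassCurve Field IsDedekindDomain NumberField
open Literature.NumberTheory.GaloisRepresentations
open Literature.NumberTheory.GaloisCohomology
open Literature.NumberTheory.EllipticCurves Literature.NumberTheory.EllipticCurves.ModularForms
open Literature.NumberTheory.EllipticCurves.Kato2004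
  Literature.NumberTheory.EllipticCurves.Kato2004.EulerSystemValues
open Literature.NumberTheory.EllipticCurves.Rank1Residual
open Literature.NumberTheory.EllipticCurves.Greenberg1999
open Literature.NumberTheory.IwasawaTheory
open Summit.BirchSwinnertonDyer.BirchSwinnertonDyer.Theorems.Rank1ResidualX1Defs
  Summit.BirchSwinnertonDyer.BirchSwinnertonDyer.Rank1Residual
  Summit.BirchSwinnertonDyer.BirchSwinnertonDyer.Rank1Residual.CoreAssembly
open Summit.BirchSwinnertonDyer.Rank1Residual Summit.BirchSwinnertonDyer.Rank1Residual.X5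
open Summit.BirchSwinnertonDyer.BirchSwinnertonDyer.Theorems.OrdKatoOptimalAtTwo
  Summit.BirchSwinnertonDyer.BirchSwinnertonDyer.Theorems.OrdKatoIntAtTwo
open Summit.BirchSwinnertonDyer.BirchSwinnertonDyer.Theses.ByReductionTypeAtTwo
open Summit.BirchSwinnertonDyer.BirchSwinnertonDyer.Theorems.AlignedTransportAtTwoFineRoad

namespace Summit.BirchSwinnertonDyer.BirchSwinnertonDyer.Theorems.SteinbergFibreAtTwo

/-! ## §1 R∞⁺ — the real-signature residual «Iw⁺ given Q⁺», displayed -/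

/-- [RESEARCH residual, OPEN — nothing asserted] **R∞⁺ — the REAL-SIGNATURE statement on the cell [`ρ̄₂` onto ∧ `0 < Δ`], as an
implication («Iw⁺ given Q⁺», pen RC-419 (1)).** For every globally minimal, non-CM, analytic-rank-`0`, good-ordinary-at-`2` curve `W/ℚ`
with `ρ̄_{W,2}` onto and `0 < Δ_W`, and every cyclotomic `ℤ₂`-extension `κ` of `ℚ`: IF the `2`-torsion of the fine Selmer group
`Sel₀(W/ℚ_∞, W[2^∞])` (STRICT at the real places) is finite, THEN so is the `2`-torsion of the fine Selmer group RELAXED at the real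
places `Sel₀^{rel ∞}(W/ℚ_∞, W[2^∞])` (Literature `fineSelmerInftyRelaxedInf`). Since `Sel₀^{rel ∞}/Sel₀ ↪ ⊕_{v ∣ ∞} H¹(ℚ_{∞,v}, W[2^∞])`
has Pontryagin dual `(Λ/2)/loc_∞(𝐇¹(T₂W))` (Poitou–Tate; `H¹(ℝ, T₂W) = ℤ/2` on a two-real-component curve), R∞⁺ reads, given (A₂):
«the universal-norm Iwasawa classes of `T₂W` over `ℚ_∞` are not all trivial at the real places» (`loc_∞ ≢ 0`, i.e. `ker loc_∞ = 2𝐇¹`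
= crux-triage's R∞, F-29b). TIER: on the cell, relaxed (A₂) ⟺ Q⁺ ∧ R∞⁺ (§2; triage r1-2 GEN 37 THEOREM I with Iw⁺ ⟹ relaxed (A₂),
§1 `…_of_lim_upstairs_of_classicalMu`), so R∞⁺ is IMPLIED by Iwasawa's `μ₂ = 0` for `ℚ(W[2], √−1)` modulo Lim 2017 Thm 3.5 at `2`
upstairs (PRINT); it is NOT known to be necessary for the crux (triage Prop J: the conjunct ⟺ Q⁺ ∧ «half class», and the half class
does not see the real signature); vacuous off the (A₂) locus, so it does not contain Q⁺. The relaxed-genuine road's research input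
beyond Q⁺, exactly. NOT a Literature fact; nothing asserted.
[cite: GreenbergLNM1716, §4 Lemma 4.6 and PDF pp. 105–107 (the archimedean Λ/2; shape only)] [cite: CoatesSujatha2005, Conj. A (shape only)]
[cite: Iwasawa1973MuInvariants, §1 (shape only)] -/
@[conjecture] def RealSignatureFineTwoOrdPosDisc : Prop :=
  ∀ (W : WeierstrassCurve ℚ) [W.IsElliptic] [W.IsGloballyMinimal], ¬ W.HasCM → W.analyticRank = 0 →
    GoodOrd W 2 → W.HasSurjectiveModNGaloisRep 2 → 0 < W.Δ →
    ∀ (κ : ZpExtension ℚ 2), κ.IsCyclotomic →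
      Set.Finite {s : W.fineSelmerInfty κ | 2 • s = 0} → Set.Finite {s : W.fineSelmerInftyRelaxedInf κ | 2 • s = 0}

/-- `RealSignatureFineTwoOrdPosDisc` unfolds to its displayed body. [folklore] -/
theorem realSignatureFineTwoOrdPosDisc_iff : RealSignatureFineTwoOrdPosDisc ↔
    ∀ (W : WeierstrassCurve ℚ) [W.IsElliptic] [W.IsGloballyMinimal], ¬ W.HasCM → W.analyticRank = 0 →
    GoodOrd W 2 → W.HasSurjectiveModNGaloisRep 2 → 0 < W.Δ →
    ∀ (κ : ZpExtension ℚ 2), κ.IsCyclotomic →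
      Set.Finite {s : W.fineSelmerInfty κ | 2 • s = 0} → Set.Finite {s : W.fineSelmerInftyRelaxedInf κ | 2 • s = 0} :=
  Iff.rfl

/-- **Monotone supplier: relaxed (A₂) on the cell in finiteness form ⟹ R∞⁺** (drop the hypothesis). [folklore] -/
theorem realSignatureFineTwoOrdPosDisc_of_relaxedFinite
    (hAr : ∀ (W : WeierstrassCurve ℚ) [W.IsElliptic] [W.IsGloballyMinimal], ¬ W.HasCM → W.analyticRank = 0 →
      GoodOrd W 2 → W.HasSurjectiveModNGaloisRep 2 → 0 < W.Δ →
      ∀ (κ : ZpExtension ℚ 2), κ.IsCyclotomic → Set.Finite {s : W.fineSelmerInftyRelaxedInf κ | 2 • s = 0}) :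
    RealSignatureFineTwoOrdPosDisc :=
  fun W _ _ hcm hr hgo h2 hΔ κ hκ _ ↦ hAr W hcm hr hgo h2 hΔ κ hκ

/-- **Iw⁺ + Lim 2017 Thm. 3.5 at `2` UPSTAIRS ⟹ R∞⁺** (indeed relaxed (A₂) outright): Iwasawa's `μ₂ = 0` for `ℚ(W[2], √−1)` (Iw⁺,
`ClassicalMuTwoDivisionFieldAdjoinIOrdPosDisc`, OPEN) gives statement (A) UPSTAIRS over `ℚ(W[2], μ_{2^∞})` by the tree's named fact
`Lim2017.thm35_at_two_upstairs_fineSelmer_twoTorsion_finite_of_classicalMuVanishes` (PRINT, statement only), and bsd-f1-sign2's kernel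
descent `LimDescent.finite_pTorsion_fineRelaxed_of_upstairs` lands in the RELAXED group downstairs (no real place upstairs). So the
(ε) supply Iw⁺ pays for R∞⁺ (triage THEOREM H (H3) / THEOREM I «⟹»). CONDITIONAL on Iw⁺ and the named fact; nothing asserted.
[cite: Lim2017FineSelmer, §3 Thm. 3.5 and Lemma 3.2] [cite: Iwasawa1973MuInvariants, §1 (shape)] [cite: CoatesSujatha2005, §3 statement (A)] -/
theorem realSignatureFineTwoOrdPosDisc_of_lim_upstairs_of_classicalMu
    (hLim : Lim2017.thm35_at_two_upstairs_fineSelmer_twoTorsion_finite_of_classicalMuVanishes)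
    (hIw : ClassicalMuTwoDivisionFieldAdjoinIOrdPosDisc) : RealSignatureFineTwoOrdPosDisc := by
  intro W _ _ hcm hr hgo h2 hΔ κ hκ _
  obtain ⟨i, hi⟩ : ∃ i : AlgebraicClosure ℚ, i ^ 2 = -1 := by
    obtain ⟨i, hi⟩ := IsAlgClosed.exists_pow_nat_eq (-1 : AlgebraicClosure ℚ) (n := 2) (by norm_num)
    exact ⟨i, hi⟩
  exact LimDescent.finite_pTorsion_fineRelaxed_of_upstairs W 2 κ hκ inf_le_right
    (LimRelUpstairs.finiteIndex_upstairs_subgroupOf W κ hκ) (hLim W i hi (hIw W hcm hr hgo h2 hΔ i hi))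

/-! ## §2 THEOREM I in the kernel: relaxed (A₂) on the cell ⟺ Q⁺ ∧ R∞⁺ -/

/-- **Q⁺ ∧ R∞⁺ ⟹ relaxed (A₂) on the cell, finiteness form**: Q⁺ (`∃ γ D` finitely generated over `ℤ₂`) gives «`Sel₀(W/ℚ_∞)[2]`
finite» (`IwasawaModuleFinitePadicInt.finite_pTorsion_of_fineSelmerDualData_moduleFinite`, Lim–Sujatha's lemma), then R∞⁺.
[cite: LimSujatha2018, §3 (before Prop. 3.2)] [cite: CoatesSujatha2005, Conj. A (shape)] -/
theorem relaxedFinite_of_conjA_of_realSignature (hQ : FineSelmerConjATwoOrdPosDisc) (hR : RealSignatureFineTwoOrdPosDisc) :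
    ∀ (W : WeierstrassCurve ℚ) [W.IsElliptic] [W.IsGloballyMinimal], ¬ W.HasCM → W.analyticRank = 0 →
      GoodOrd W 2 → W.HasSurjectiveModNGaloisRep 2 → 0 < W.Δ →
      ∀ (κ : ZpExtension ℚ 2), κ.IsCyclotomic → Set.Finite {s : W.fineSelmerInftyRelaxedInf κ | 2 • s = 0} := by
  intro W _ _ hcm hr hgo h2 hΔ κ hκ
  obtain ⟨_, D, hD⟩ := hQ W hcm hr hgo h2 hΔ κ hκ
  exact hR W hcm hr hgo h2 hΔ κ hκ (IwasawaModuleFinitePadicInt.finite_pTorsion_of_fineSelmerDualData_moduleFinite W κ D hD)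

/-- **Q⁺ ∧ R∞⁺ ⟹ relaxed (A₂) on the cell IN THE RELAXED `μ`-DOOR'S CURRENCY**: for every cell curve, cyclotomic `(κ, γ)` and every
relaxed fine dual datum `Yr` (`X₀^{rel ∞}`), `ℓ₍₂₎(Yr.X) = 0` (bsd-f1-sign2's `LimRelUpstairs.lengthAt_relaxed_eq_zero_of_finite_pTorsion`).
This is the hypothesis `hAr` of w2's `ordKatoHalfAtTwoIsoPosDisc_of_relaxedZeta_of_arch_of_relaxedConjA`. CONDITIONAL; nothing asserted.
[cite: LimSujatha2018, §3 (before Prop. 3.2)] [cite: GreenbergLNM1716, §1 p. 60 (μ = 0 ⟺ X/pX finite; shape)] -/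
theorem relaxedConjATwoPosDisc_of_conjA_of_realSignature (hQ : FineSelmerConjATwoOrdPosDisc)
    (hR : RealSignatureFineTwoOrdPosDisc) :
    ∀ (W : WeierstrassCurve ℚ) [W.IsElliptic] [W.IsGloballyMinimal], ¬ W.HasCM → W.analyticRank = 0 →
      GoodOrd W 2 → W.HasSurjectiveModNGaloisRep 2 → 0 < W.Δ →
      ∀ (κ : ZpExtension ℚ 2) (γ : absoluteGaloisGroup ℚ), κ.IsCyclotomic → κ.IsTopGenerator γ →
      ∀ Yr : W.FineSelmerDualDataRelaxedInf κ γ,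
        Module.lengthAt (IwasawaAlgebra 2) Yr.X ⟨IwasawaAlgebra.augIdealP 2, IwasawaAlgebra.isPrime_augIdealP_holds 2⟩ = 0 :=
  fun W _ _ hcm hr hgo h2 hΔ κ _ hκ hγ Yr ↦
    LimRelUpstairs.lengthAt_relaxed_eq_zero_of_finite_pTorsion W κ hγ Yr
      (relaxedFinite_of_conjA_of_realSignature hQ hR W hcm hr hgo h2 hΔ κ hκ)

/-- **Conversely, relaxed (A₂) on the cell (finiteness form) ⟹ Q⁺ ∧ R∞⁺**: the strict fine Selmer group sits inside the relaxed one
(`fineSelmerInfty_le_fineSelmerInftyRelaxedInf`), so its `2`-torsion is finite too, which is Q⁺ in the `∃ γ D` spelling by Lim–Sujatha's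
lemma (`IwasawaModuleFinitePadicInt.exists_fineSelmerDualData_moduleFinite_iff_finite_pTorsion`); R∞⁺ by §1. With §2's first theorem:
**relaxed (A₂) ⟺ Q⁺ ∧ R∞⁺ on the cell** — the kernel form of triage THEOREM I's exchange rate (Iw⁺ enters only through relaxed (A₂)).
[cite: LimSujatha2018, §3 (before Prop. 3.2)] [cite: CoatesSujatha2005, Conj. A (shape)] -/
theorem conjA_and_realSignature_of_relaxedFinite
    (hAr : ∀ (W : WeierstrassCurve ℚ) [W.IsElliptic] [W.IsGloballyMinimal], ¬ W.HasCM → W.analyticRank = 0 →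
      GoodOrd W 2 → W.HasSurjectiveModNGaloisRep 2 → 0 < W.Δ →
      ∀ (κ : ZpExtension ℚ 2), κ.IsCyclotomic → Set.Finite {s : W.fineSelmerInftyRelaxedInf κ | 2 • s = 0}) :
    FineSelmerConjATwoOrdPosDisc ∧ RealSignatureFineTwoOrdPosDisc := by
  refine ⟨fun W _ _ hcm hr hgo h2 hΔ κ hκ ↦ ?_, realSignatureFineTwoOrdPosDisc_of_relaxedFinite hAr⟩
  obtain ⟨γ₀, hγ₀⟩ : ∃ γ : absoluteGaloisGroup ℚ, κ.IsTopGenerator γ := κ.surjective (Multiplicative.ofAdd 1)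
  refine (IwasawaModuleFinitePadicInt.exists_fineSelmerDualData_moduleFinite_iff_finite_pTorsion W κ hγ₀).mpr ?_
  -- the strict `2`-torsion embeds into the relaxed `2`-torsion
  let ι : W.fineSelmerInfty κ → W.fineSelmerInftyRelaxedInf κ :=
    fun s ↦ ⟨s.1, W.fineSelmerInfty_le_fineSelmerInftyRelaxedInf κ s.2⟩
  have hι : Function.Injective ι := fun s t hst ↦ by
    have h := congrArg Subtype.val hst
    exact Subtype.ext h
  refine Set.Finite.of_finite_image ((hAr W hcm hr hgo h2 hΔ κ hκ).subset ?_) hι.injOn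
  rintro _ ⟨s, hs, rfl⟩
  have hs' : 2 • (s : W.subgroupH1 2 κ.kerSubgroup) = 0 := by
    have := congrArg Subtype.val hs
    simpa using this
  show 2 • ι s = 0
  exact Subtype.ext (by simpa using hs')

/-! ## §3 DOORS BY NAME: the conjunct, the PAIR child, the crux (v17 composition) -/

/-- **The `0 < Δ` conjunct `OrdKatoHalfAtTwoIsoPosDisc` BY NAME ⟸ R⁺ (Kato's GENUINE zeta classes in relaxed-at-`∞` Coleman coordinates,
memo) + Aʳ (the archimedean `Λ/2`, reserve/kernel-able) + Q⁺ (Coates–Sujatha (A) at `2`, strict — the cell's named research target)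
+ R∞⁺ (real signature, «Iw⁺ given Q⁺») + PRINT {Abbes–Ullmo, Kato 17.4 (1)(2) at `2`}.** One application of w2 GEN 5's
`ordKatoHalfAtTwoIsoPosDisc_of_relaxedZeta_of_arch_of_relaxedConjA` (p705378) with its relaxed-(A₂) input from §2. NO half class, NO
Euler-system bound at `2`. CONDITIONAL on the displayed OPEN statements; nothing closed.
[cite: Kato2004Asterisque, Thm. 17.4 (1)(2) (p. 273), Prop. 17.11 (p. 277), §17.13 (pp. 279–280)] [cite: AbbesUllmo1996, Thm. A]
[cite: CoatesSujatha2005, Conj. A (shape)] [cite: GreenbergLNM1716, §4 Lemma 4.6 (shape)] -/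
theorem ordKatoHalfAtTwoIsoPosDisc_of_relaxedZeta_of_arch_of_conjA_of_realSignature (hR : RelaxedZetaColemanIotaPosDiscAtTwo)
    (hA : ArchimedeanLambdaModTwoOrdAtTwo) (hQ : FineSelmerConjATwoOrdPosDisc) (hRinf : RealSignatureFineTwoOrdPosDisc)
    (hAU : abbesUllmo_not_dvd_maninConstant_of_not_dvd_level)
    (h17 : ∀ (V : WeierstrassCurve ℚ) [V.IsElliptic] [V.IsGloballyMinimal] [NeZero (V.conductorNorm ℤ)]
      (f : CuspForm (Gamma0 (V.conductorNorm ℤ)) 2), kato_divisibility_allPrimes V 2 (f := f)) :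
    OrdKatoHalfAtTwoIsoPosDisc :=
  ordKatoHalfAtTwoIsoPosDisc_of_relaxedZeta_of_arch_of_relaxedConjA hR hA
    (relaxedConjATwoPosDisc_of_conjA_of_realSignature hQ hRinf) hAU h17

/-- **The PAIR child `OrdKatoFineZetaAtTwoResidue` (stmt-BirchSwinnertonDyer-24097) BY NAME**: F1μι⁻ (conjunct 1 verbatim, memo) and the
relaxed-genuine road on conjunct 2 (R⁺ + Aʳ + Q⁺ + R∞⁺ + Abbes–Ullmo + Kato 17.4 (1)(2)@2). CONDITIONAL; nothing closed.
[cite: Kato2004Asterisque, Thm. 12.6, 16.6, Prop. 17.11, §17.13 (shape)] [cite: CoatesSujatha2005, Conj. A (shape)] -/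
theorem ordKatoFineZetaAtTwoResidue_of_negDisc_of_relaxedZeta_of_arch_of_conjA_of_realSignature
    (hNeg : ZetaColemanMuIotaNegDiscAtTwo) (hR : RelaxedZetaColemanIotaPosDiscAtTwo) (hA : ArchimedeanLambdaModTwoOrdAtTwo)
    (hQ : FineSelmerConjATwoOrdPosDisc) (hRinf : RealSignatureFineTwoOrdPosDisc)
    (hAU : abbesUllmo_not_dvd_maninConstant_of_not_dvd_level)
    (h17 : ∀ (V : WeierstrassCurve ℚ) [V.IsElliptic] [V.IsGloballyMinimal] [NeZero (V.conductorNorm ℤ)]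
      (f : CuspForm (Gamma0 (V.conductorNorm ℤ)) 2), kato_divisibility_allPrimes V 2 (f := f)) :
    OrdKatoFineZetaAtTwoResidue :=
  ordKatoFineZetaAtTwoResidue_of_halves hNeg
    (ordKatoHalfAtTwoIsoPosDisc_of_relaxedZeta_of_arch_of_conjA_of_realSignature hR hA hQ hRinf hAU h17)

/-- **THE CRUX `OrdKatoHalfAtTwoIso` BY NAME through the RELAXED-GENUINE road — the DISPLAYED ALTERNATIVE DOOR of skeleton v17 of line
`steinberg-fibre-at-two` (pen RC-422 (1); the composition of a would-be second line `steinberg-fibre-at-two-relaxed`), extent «crux-content ∧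
R∞» (triage COROLLARY K)** ⟸ F1μι⁻ (memo, `Δ < 0`) · R⁺ (memo, `0 < Δ`, GENUINE classes) · Aʳ (print-composite reading, reserve) · Q⁺
(research, necessary) · R∞⁺ (research residual «Iw⁺ given Q⁺», NOT known necessary) · Col½-opt-off514 (memo, not-onto cell off the 5.14
locus) · PRINT {bundle 23889 = PUB ∧ Abbes–Ullmo ∧ Greenberg 5.14@2 (consumed), Lim 2017 Thm 3.5 at `2`, Ferrero–Washington}: lead g5's split
door `ordKatoHalfAtTwoIso_of_iota_halves` (p695020) with the `0 < Δ` conjunct from this file and B7′ from the lead g7 off-5.14 door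
`katoMuPartOff514_of_print_of_colemanHalfClassPackage_off514` (p705499). NO half class anywhere on the onto cells. CONDITIONAL on the displayed
OPEN statements; nothing closed; the REGISTERED composition of the line remains the (ε) one (p705499 §2). [cite: Kato2004Asterisque, Thm. 17.4 (1)(2) (p. 273), §17.13]
[cite: GreenbergLNM1716, Prop. 5.14 (p. 130)] [cite: AbbesUllmo1996, Thm. A] [cite: Lim2017FineSelmer, §3 Thm. 3.5 and Lemma 3.2]
[cite: FerreroWashington1979, main theorem] -/
theorem ordKatoHalfAtTwoIso_of_negDisc_of_relaxedZeta_of_arch_of_conjA_of_realSignature_of_halfClassOff514_of_print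
    (hNeg : ZetaColemanMuIotaNegDiscAtTwo) (hR : RelaxedZetaColemanIotaPosDiscAtTwo) (hA : ArchimedeanLambdaModTwoOrdAtTwo)
    (hQ : FineSelmerConjATwoOrdPosDisc) (hRinf : RealSignatureFineTwoOrdPosDisc)
    (hCol : ∀ (W : WeierstrassCurve ℚ) [W.IsElliptic] [W.IsGloballyMinimal],
      ¬ W.HasCM → GoodOrd W 2 → ¬ W.HasSurjectiveModNGaloisRep 2 →
      ∀ (W₀ : WeierstrassCurve ℚ) [W₀.IsElliptic] [W₀.IsGloballyMinimal] {N₀ : ℕ} [NeZero N₀]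
        (D₀ : ModularParametrizationData W₀ N₀), WeierstrassCurve.IsIsogenous W W₀ →
        (∀ z ∈ D₀.L.lattice, ∃ w ∈ periodLattice D₀.f, z = D₀.c * w) →
        (¬ ∃ x y : ℚ, W₀.toAffine.Equation x y ∧ 2 * y + W₀.a₁ * x + W₀.a₃ = 0 ∧
          ((TwoTorsionRamifiedAtTwo x ∧ ¬ TwoTorsionOdd W₀ x) ∨
            (TwoTorsionOdd W₀ x ∧ ¬ TwoTorsionRamifiedAtTwo x))) →
      ∀ {N : ℕ} [NeZero N] (f : CuspForm (Gamma0 N) 2) (κ : ZpExtension ℚ 2) (γ : absoluteGaloisGroup ℚ),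
        κ.IsCyclotomic → κ.IsTopGenerator γ → IsCyclotomicVariable 2 γ → IsNewformOf W₀ f →
        ∀ (D : W₀.SelmerDualData κ γ) (Y : W₀.FineSelmerDualData κ γ), HasColemanHalfClassPackageAtTwo W₀ f κ γ D Y)
    (hbundle : OrdPublishedInputsAtTwo ∧ abbesUllmo_not_dvd_maninConstant_of_not_dvd_level ∧
      Greenberg1999.prop514_isTorsion_mu_eq_zero_two)
    (hLim2 : Lim2017.thm35_at_two_fineSelmerDual_moduleFinite_of_classicalMuVanishes_of_le_divisionField_four)
    (hFW : ferreroWashington1979_classicalMuVanishes) : OrdKatoHalfAtTwoIso := by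
  have hAU := hbundle.2.1
  obtain ⟨hMod, _, h17, _⟩ := hbundle.1
  exact ordKatoHalfAtTwoIso_of_iota_halves hNeg
    (ordKatoHalfAtTwoIsoPosDisc_of_relaxedZeta_of_arch_of_conjA_of_realSignature hR hA hQ hRinf hAU h17)
    hbundle (katoMuPartOff514_of_print_of_colemanHalfClassPackage_off514 hAU hMod hLim2 hFW hCol)

end Summit.BirchSwinnertonDyer.BirchSwinnertonDyer.Theorems.SteinbergFibreAtTwo

end
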